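import Summits.QuantumFields.BalabanUV.Beta.GAN24.KSlotAssembly
import Summits.QuantumFields.BalabanUV.Beta.HessKerCoDressedBmWall

/-!
# `BalabanUV.Beta.GAN24.DressedStepDifferenceRows` — binder row G-an2-4 ∕ (CONV-C), W-slot, the (α-0) parity re-cut, located crux (Q-L-k₀), the DRIFT rows
# (leaf-03 g68 A-3∕A-4 l.54714∕54745: the composite kernel-DIFFERENCE windows (H1Δw) need «the dressed-kernel-difference letters»; OWNER `b2b-balaban-gan24-p1` gen 37, part 7):
# **THE SOCKET's DRESSED UNIT STEP KERNELS `K♮ᴱ_j` HAVE `j`-UNIFORM DECAY AND GEOMETRICALLY SMALL CONSECUTIVE (ALL-SCALES) DIFFERENCES — ONE SET OF CONSTANTS FOR EVERY IN-BLOCK ROOT.**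

NOT IN PRINT; OUR BOOKKEEPING ([folklore] instantiation BY NAME: the K-slot `KSlotAssembly.convCKWall_holds` (✓, `UnitDecayK ∧ CauchyDecayK` of the unit-normalised step resolvents)
through asym1's `HessKerCoDressedBmWall.exists_coDressedBm_unit_rows` (✓, the block-mean co-dressing is additive on spread kernels and transports decay at rate `δ_K∕4`), the
root made uniform by a finite sum over the root box; 0 `def`, 0 cited facts, 0 `def … : Prop`, 0 sorry).  HONEST FRAMING (cell contract, verbatim): «discharging `BetaPertH` makes
Bałaban's UV stability UNCONDITIONAL — a real constructive-QFT result; it is NOT the continuum limit and NOT the Clay problem.»  HONEST DEPENDENCY (verbatim): «continuum YM on T⁴ ⇐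
BetaPertH ∧ nine spine estimates (0/9 proved); BetaPertH ⇐ (D1) ∧ (D4) ∧ CAP+tail; G-an2-4 gates asym, D1 and NE2/3/4.»

WHAT (`d = 3`, `2 ≤ Lc`, `K♮ᴱ_j(rr) := unitK (sfStep Lc j) (smStep 3 Lc j) (coDressKBmAt (toSite rr) Lc (KInvStep Lc j))`):
**`exists_dressedStep_rows`** — `∃ C cK θ δ, 0 < δ ∧ 0 ≤ θ ∧ θ < 1 ∧ 0 ≤ C ∧ 0 ≤ cK ∧ ∀ rr ∈ box (3+1) Lc, (∀ j, Decays (K♮ᴱ_j) C δ) ∧ (∀ l j, Decays (K♮ᴱ_{l+j} − K♮ᴱ_l) (cK·θ^l) δ)`;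
`decays_dressedStep_sub_succ` — the consecutive case `j = 1` read off.  These are the KERNEL-side letters of the drift windows (H1Δw) (a `(q+1)`-chain whose first step carries
`K♮ᴱ_{l+1} − K♮ᴱ_l` in ONE of its three legs: every leg built from the difference kernel — `krow`, `colH` and their composites — inherits the factor `cK·θ^l` through leaf-01's
`klegDecay_krow` ∕ `legDecay_colH` and the chain recursions); the WINDOW with one different kernel family in one leg is leaf-01's to state (the step map is trilinear).
Asserts NOTHING about Bałaban's tables beyond the tree's K-slot; NOT (H1Δw); NOTHING of (Q-L) ∕ (C)sym discharged; NEVER «G-an2-4 closed» as (CONV-C); NOT D1, NOT `BetaPertH`,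
NOT continuum, NOT Clay; not in print.  Unit `b2b-balaban-gan24-p1` (BINDER row G-an2-4 OWNER; CRUX PROVER on C-R8° CT-ROUTE), gen 37, 2026-08-23.
-/

noncomputable section

open Finset
open scoped BigOperators
open Literature.MathematicalPhysics.QuantumFieldTheory
open Literature.MathematicalPhysics.QuantumFieldTheory.Balaban1983to89
open Literature.MathematicalPhysics.QuantumFieldTheory.Balaban1983to89.Beta
open B12Sec2to5 (l1)
open ExpKernelCalculus (MKer Decays)
open OneStepResolventKernel (Fib decays_mono)
open OneStepKernelFamily (KInvStep)
open AffineAveraging (box toSite)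
open Summit.QuantumFields.BalabanUV.Beta.HessKerDressedUnits (unitK)
open Summit.QuantumFields.BalabanUV.Beta.HessKerCoDressedBmWall (exists_coDressedBm_unit_rows)
open Summit.QuantumFields.BalabanUV.Beta.AxialDressingRooted (coDressKBmAt)
open Summit.QuantumFields.BalabanUV.Beta.GAN24.CombesThomas (sfStep smStep sfStep_ne_zero smStep_ne_zero)
open Summit.QuantumFields.BalabanUV.Beta.GAN24.KSlotAssembly (convCKWall_holds)

namespace Summit.QuantumFields.BalabanUV.Beta.GAN24.DressedStepDifferenceRows

variable {Lc : ℕ} [NeZero Lc]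

/-- [folklore] A decay row forces a nonnegative constant. -/
theorem nonneg_of_decays {K : MKer (3 + 1) (Fib 3)} {C δ : ℝ} (h : Decays K C δ) : 0 ≤ C := by
  have h0 := h 0 0 (Sum.inl 0) (Sum.inl 0)
  rw [sub_self] at h0
  have : l1 (0 : Fin (3 + 1) → ℤ) = 0 := by unfold l1; simp
  rw [this, mul_zero, Real.exp_zero, mul_one] at h0
  exact (abs_nonneg _).trans h0

/-- NOT IN PRINT; OUR BOOKKEEPING.  **THE DRESSED UNIT STEP KERNELS: `j`-UNIFORM DECAY AND GEOMETRICALLY SMALL ALL-SCALES DIFFERENCES, UNIFORMLY IN THE IN-BLOCK ROOT**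
(as displayed in the module docstring). -/
theorem exists_dressedStep_rows (hLc : 2 ≤ Lc) :
    ∃ C cK θ δ : ℝ, 0 < δ ∧ 0 ≤ θ ∧ θ < 1 ∧ 0 ≤ C ∧ 0 ≤ cK ∧ ∀ (rr : Fin (3 + 1) → ℕ), rr ∈ box (3 + 1) Lc →
      (∀ j : ℕ, Decays (unitK (sfStep Lc j) (smStep 3 Lc j) (coDressKBmAt (toSite rr) Lc (KInvStep (d := 3) Lc j))) C δ) ∧
      (∀ l j : ℕ, Decays (unitK (sfStep Lc (l + j)) (smStep 3 Lc (l + j)) (coDressKBmAt (toSite rr) Lc (KInvStep (d := 3) Lc (l + j)))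
          - unitK (sfStep Lc l) (smStep 3 Lc l) (coDressKBmAt (toSite rr) Lc (KInvStep (d := 3) Lc l))) (cK * θ ^ l) δ) := by
  classical
  have hLc1 : 1 ≤ Lc := le_trans (by norm_num) hLc
  obtain ⟨CK, δK, cK, θ, hδK, hθ0, hθ1, hU, hC⟩ := convCKWall_holds (Lc := Lc) hLc
  have hCK : 0 ≤ CK := nonneg_of_decays (hU 0)
  have hcK : 0 ≤ cK := by
    have h := nonneg_of_decays (hC 0 0)
    simpa only [pow_zero, mul_one] using h
  -- per root: asym1's transfer; then a finite sum over the root box makes the constant uniform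
  have hroot : ∀ (rr : Fin (3 + 1) → ℕ), rr ∈ box (3 + 1) Lc → ∃ c : ℝ, 0 ≤ c ∧
      (∀ j : ℕ, Decays (unitK (sfStep Lc j) (smStep 3 Lc j) (coDressKBmAt (toSite rr) Lc (KInvStep (d := 3) Lc j))) (c * CK) (δK / 4)) ∧
      (∀ l j : ℕ, Decays (unitK (sfStep Lc (l + j)) (smStep 3 Lc (l + j)) (coDressKBmAt (toSite rr) Lc (KInvStep (d := 3) Lc (l + j)))
          - unitK (sfStep Lc l) (smStep 3 Lc l) (coDressKBmAt (toSite rr) Lc (KInvStep (d := 3) Lc l))) (c * cK * θ ^ l) (δK / 4)) :=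
    fun rr hrr => exists_coDressedBm_unit_rows (d := 3) hLc1 hrr (sfStep Lc) (smStep 3 Lc) (fun j => sfStep_ne_zero j) (fun j => smStep_ne_zero j)
      (K := fun j => KInvStep (d := 3) Lc j) hδK hU hC
  choose c hc0 hrow hdiff using hroot
  set cmax : ℝ := ∑ x ∈ (box (3 + 1) Lc).attach, c x.1 x.2 with hcmax
  have hcmax0 : 0 ≤ cmax := Finset.sum_nonneg fun x _ => hc0 x.1 x.2
  have hle : ∀ (rr : Fin (3 + 1) → ℕ) (hrr : rr ∈ box (3 + 1) Lc), c rr hrr ≤ cmax := fun rr hrr =>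
    Finset.single_le_sum (f := fun x : {x // x ∈ box (3 + 1) Lc} => c x.1 x.2) (fun x _ => hc0 x.1 x.2) (Finset.mem_attach _ ⟨rr, hrr⟩)
  refine ⟨cmax * CK, cmax * cK, θ, δK / 4, by positivity, hθ0, hθ1, by positivity, by positivity, ?_⟩
  intro rr hrr
  refine ⟨fun j => ?_, fun l j => ?_⟩
  · exact decays_mono (hrow rr hrr j) (by positivity [hc0 rr hrr]) (mul_le_mul_of_nonneg_right (hle rr hrr) hCK) le_rfl
  · exact decays_mono (hdiff rr hrr l j) (by positivity [hc0 rr hrr])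
      (by rw [mul_assoc, mul_assoc]; exact mul_le_mul_of_nonneg_right (hle rr hrr) (by positivity)) le_rfl

/-- [folklore] The consecutive differences read off: `Decays (K♮ᴱ_{l+1} − K♮ᴱ_l) (cK·θ^l) δ` for every in-block root and every level. -/
theorem exists_dressedStep_sub_succ (hLc : 2 ≤ Lc) :
    ∃ cK θ δ : ℝ, 0 < δ ∧ 0 ≤ θ ∧ θ < 1 ∧ 0 ≤ cK ∧ ∀ (rr : Fin (3 + 1) → ℕ), rr ∈ box (3 + 1) Lc → ∀ l : ℕ,
      Decays (unitK (sfStep Lc (l + 1)) (smStep 3 Lc (l + 1)) (coDressKBmAt (toSite rr) Lc (KInvStep (d := 3) Lc (l + 1)))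
          - unitK (sfStep Lc l) (smStep 3 Lc l) (coDressKBmAt (toSite rr) Lc (KInvStep (d := 3) Lc l))) (cK * θ ^ l) δ := by
  obtain ⟨C, cK, θ, δ, hδ, hθ0, hθ1, -, hcK, h⟩ := exists_dressedStep_rows (Lc := Lc) hLc
  exact ⟨cK, θ, δ, hδ, hθ0, hθ1, hcK, fun rr hrr l => (h rr hrr).2 l 1⟩

end Summit.QuantumFields.BalabanUV.Beta.GAN24.DressedStepDifferenceRows

end
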